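import Mathlib
import Literature.MathematicalPhysics.QuantumFieldTheory.Balaban1983to89.T4CubeShellSteinSeed

/-!
# Cube-shell conditioning XI: the Z-ROW (M-matrix) SUB-CLASS `P_M(m₂)` — conditioning-closed, `ℓ^∞`- and
`ℓ¹`-coercive Hessians, the INTERIOR-MODE theorem and its DEPTH-INDEPENDENCE along the conditioning orbit, and the
reduction of module X's wall term to PER-FACE fluxes

Landing edition «CubeShell XI» of the ideation cell `ym-nodeO-ideate` (seat P1, lens «inside Bałaban»; memo
`memos/ROUTE-P1.md` §0y.42, companion 47 `memos/ROUTE-P1-SketchCubeShellXI.lean`), over the landed modules I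
`T4CubeShellBlocks`, IV `T4CubeShellConditional`, VII `T4CubeShellProfile` (seat P8), VIII `T4CubeShellProfileP`, X
`T4CubeShellSteinSeed` of this directory.  Module X reduced the windowed decay estimate for one action in `𝔐_ε` to ONE
input — a uniform bound on the WALL TERM `Wall_w(Φ̃)` of the hard window — and LOCATED the obstruction: for `𝔐`, `𝔐_ε` as
typed, corner boundary data can push the mode of a conditional child onto (or beyond) a face of `[-S,S]ⁿ`, and no margin
preventing this survives the iterated conditioning.  The memo's road (d) proposed a SUB-CLASS on which it does survive:
Hessian rows that are Z-ROWS (non-positive off-diagonal entries — ferromagnetic couplings) with ROW SUMS `≥ m₂ > 0`, i.e.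
(pointwise) strictly diagonally dominant M-matrix Hessians.  THIS FILE TYPES ROAD (d) AS FAR AS IT GOES: the sub-class is
conditioning-closed (d1); its conditional critical points stay `S·m₂∕R` inside the window for EVERY boundary field in the
window, with a margin that is the SAME for every descendant of the conditioning orbit (d2); the solving direction of
module X has `ℓ¹`-mass `≤ a∕m₂` uniformly in the volume (d4); hence the wall term splits into at most `‖w‖₁ ≤ a∕m₂` times
the largest PER-FACE flux `Wall_{e_l}(Φ̃)` — and what is left of the windowed programme on this class is ONE estimate on
one face at a time, for a density whose every line-restriction has its mode `≥ S·m₂∕R` away from that face (d3, NOT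
proved here).  Sorry-free; no `axiom`; no `instance`; no notation; modules I ∕ IV ∕ VII ∕ VIII ∕ X BY NAME, nothing
restated.  («CubeShell XI» here names the road-(d) rungs; the memo's structural item "re-centred windows" is a different,
un-typed object and is not touched.)

WHAT IS TYPED HERE (printed ingredients: Z-matrices ∕ nonsingular M-matrices and their characterisations
[BermanPlemmons1994, Ch. 6 Thm 2.3 (I₂₇)–(I₂₉), (M₃₅); Thm 2.4 (iii)], the Levy–Desplanques theorem and strict diagonal
dominance [HornJohnson2013, Cor. 5.6.17, Def. 6.1.9, Thm 6.1.10 (a)], the `ℓ^∞` bound for the inverse of a strictly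
diagonally dominant matrix [Varah1975], M-FUNCTIONS — off-diagonally antitone, inverse isotone gradient maps
[OrtegaRheinboldt2000, Def. 13.5.1, Def. 13.5.3, 13.5.6, Def. 13.5.7]; Brascamp–Lieb [BrascampLieb1976, Thm 4.1]; the DLR
structure of finite-range specifications [FriedliVelenik2017, Lemma 6.7]; the profile recursion of [Martinelli1999, §2.4];
the full-space analogue [HelfferSjostrand1994], [Ledoux2001, Prop. 6.2 p.190]):
* §1–§2 finite-dimensional Z-ROW INEQUALITIES: at a maximal coordinate the off-diagonal terms only help
  (`zrow_sum_lower ∕ _upper`, `zrow_offsum_ge`); `ZRows M μ` (Z-rows with margins), diagonal dominance `ZRows.diag_ge`,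
  the discrete maximum principle `ZRows.mulVec_ge ∕ abs_mulVec_ge` and THE `ℓ^∞` RESOLVENT BOUND `ZRows.linfty_le`:
  `‖v‖_∞ ≤ ‖Mv‖_∞ ∕ m₂` (Varah), trivial kernel;
* §3 THE SUB-CLASS: `ZRow m₂ f` — at every point every Hessian row `∇∂_k f` has entries `≤ 0` off `k` and sum `≥ m₂` —
  and `P_M(m₂) = MMatrix 𝔖 m₂ = 𝔐 ∩ ZRow m₂`; the `λ`-Gaussian is a member for `m₂ ≤ λ` (`mMatrix_gauss`); (d1)
  `zRow_condPot` ∕ `condClosed_mMatrix`: `P_M(m₂)` IS CONDITIONING-CLOSED for `m₂ ≤ λ` (an inside Hessian row of the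
  child is the `{lab ≠ 1}`-masked parent row — masking keeps signs and does not lower a Z-row sum — every other row is
  `λ e_k`), and so is `P_M(m₂) ∩ 𝔐_ε` (`condClosed_mMatrix_nearGauss`, with VIII `condClosed_nearGauss`); `diag_le_R`;
* §4 `ℓ^∞`-MONOTONICITY OF THE GRADIENT MAP (the M-function property, quantitative): `grad_sub_ge` (at a maximal
  coordinate of `y − y'`, `m₂ (y − y')_k ≤ ∂_k f(y) − ∂_k f(y')`, by the 1-D mean value inequality along the segment),
  `abs_sub_le_of_grad`: `m₂ ‖y − y'‖_∞ ≤ ‖∇f(y) − ∇f(y')‖_∞`, `eq_of_grad_eq`;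
* §5–§6 THE INTERIOR-MODE THEOREM `abs_crit_le`: `f ∈ C²` with `ZRow m₂`, `m₂ > 0`, Hessian diagonal `≤ R`; a block `I`,
  a point `p` with `|p_i| ≤ S` OFF the block, `∂_k f(0) = 0` and `∂_k f(p) = 0` ON the block ⇒ `|p_k| ≤ S(1 − m₂∕R)` on
  the block (`crit_le` ∕ `le_crit`: along `s ↦ ∂_k f(s p)` at the extremal block coordinate `k`, the Z-row structure gives
  `φ' ≥ p_k R − S(R − m₂)`, and `φ(0) = φ(1) = 0`); for the spec: `mMatrix_crit_le`; for the INSIDE CHILD of the recursion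
  `condPot_crit_le` ∕ `condPot_crit_dist`: for `f ∈ P_M(m₂)` normalised on the inside rows, a WIDE labelling and ANY
  boundary field `x ∈ [-S,S]ⁿ`, an inside-critical point `z` of `condPot lab λ (fLo lab f) x` has `S·m₂∕R ≤ S − |z_k|`;
* §7 (d2) DEPTH-INDEPENDENCE: the property `IntMode 𝔖 δ f` («every block-critical point with off-block data in the window
  lies in the `δ`-shrunken window») passes to both conditional children WITH THE SAME `δ` (`intMode_condPot`: the child's
  inside critical equation IS the parent's at `merge lab x p`, the other rows give `p_k = 0`; no derivative estimate), so
  `IntMode δ` is CONDITIONING-CLOSED (`condClosed_intMode`, `δ ≤ S`), the road-(d) class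
  `P_M(m₂) ∩ 𝔐_ε ∩ IntMode δ` is conditioning-closed and contains the Gaussian (`condClosed_roadD`, `roadD_gauss`) and
  every normalised member with `δ = S·m₂∕R` (`roadD_mem`), and along module VIII's `Orbit` of a normalised
  `f₀ ∈ P_M(m₂)`: EVERY descendant is in `P_M(m₂)` with `IntMode (S·m₂∕R)` (`orbit_intMode`);
* §8 (d4) THE `ℓ¹` BOUND: a Z-matrix with COLUMN sums `≥ m₂` has `m₂‖w‖₁ ≤ ‖Mw‖₁` (`zcol_l1_le`, test against `sign w`);
  `ZRow` bounds exactly the columns of `coordHessian` (no symmetry used), so `m₂‖w‖₁ ≤ ‖f_xx(y)w‖₁`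
  (`ZRow.hessian_l1_le`) and module X's solving direction `g_xx(z₀) w = ∇G(z₀)` (`∇G` supported in `B_r(j)`, entries
  `≤ 1`) has `‖w‖₁ ≤ a∕m₂` UNIFORMLY in `n` (`ZRow.dir_l1_le`, `dir_l1_le_partner`) — which Combes–Thomas alone does not
  give (its rate is tied to `λ∕(Ra)`, not to the volume growth); X's crude (W3) is thereby uniform too (`dir_l1_osc_le`);
* §9 THE WALL TERM SPLITS INTO FACES: `cubeMean_sum_mul`, `wallDefect_eq_sum` (`Wall_w(Ψ) = Σ_l w_l Wall_{e_l}(Ψ)`),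
  `abs_wallDefect_le` (`|Wall_w(Ψ)| ≤ ‖w‖₁ max_l |Wall_{e_l}(Ψ)|`), and THE FINAL FORM `kappaE_seed_of_faces`: for
  `P ⊆ {RowOsc ε} ∩ {ZRow m₂}`, `0 < m₂ ≤ λ`, range `r ≥ 1`, `μ ≥ 0` with `R a (e^μ − 1) ≤ λ∕2`,
      `c A q κ^E_P(s₀) ≤ ρ`  ⇐  for every exact child triple SOME base point `z₀` (with THE direction `w`) and a bound
      `ω` of the `2n` face terms `|Wall_{e_l}(Φ − ⟨Φ⟩_K)|` have
      `a²(2∕λ) e^{−μ s₀∕r} + (a∕m₂) ω + λ⁻¹(C⁻¹ + a∕λ) ε ≤ ρ ∕ (c A q)`.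
  So on the Z-row class the ENTIRE windowed decay estimate is reduced to a PER-FACE flux bound `ω`, with a volume-free
  weight `a∕m₂`, for conditional densities all of whose block-critical points — in particular the minimiser of every
  coordinate LINE restriction, a block of one site — keep the distance `S·m₂∕R` from the face (§7).
THE REMAINING RUNG (d3), stated precisely and NOT proved here.  Along a coordinate line the child's density `e^{-h}`,
`h'' ≥ λ`, has its minimiser `s*` with `|s*| ≤ S − d`, `d = S·m₂∕R` (§7 with the one-site block), whence
`e^{-h(±S)} ≤ η ∫_{-S}^{S} e^{-h}` with `η(λ, d) = λd ∕ (e^{λd²∕2} − 1)` (compare `h` with its tangent parabola at `s*`);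
integrating over the face (Tonelli) and using `|Φ̃| ≤ 2S√a`, `|∂Φ| ≤ 1` gives `ω ≤ 4 η S (√a + 1)` uniformly in `n`
and in the boundary field — small once `λ S² m₂² ∕ R² ≫ log S`.  Typing it needs the face-integral form of `Wall_{e_l}`
(module X `wallDefect_single_mul_cubeMass`, from the tree's `stein_faces`) and a Tonelli argument over the face; it is
the one place where this file stops.
WHAT THIS FILE DOES NOT CLAIM.  (i) No seed and no decay estimate is PROVED, for `P_M(m₂)` or anything else: the face
bound `ω` is a HYPOTHESIS of `kappaE_seed_of_faces`, and (d3) above is a sketch in this docstring only; (ii) the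
interior-mode theorems take the EXISTENCE of the critical point as a hypothesis (`hcrit`) — they locate it, they do not
produce it — and the normalisation `∇f(0) = 0` of the root action is a hypothesis; (iii) the Z-row condition is NOT
claimed for any effective action of a renormalisation programme — lattice gauge-field Hessians are not Z-matrices in
general (plaquette couplings carry both signs) — it is the typed sub-class of the WINDOWED cube model (GLOBAL Hessian
bounds, FINITE range) on which the located obstruction of module X disappears at the level of the modes; (iv) nothing
here is an estimate on any density of Bałaban's programme, nor a statement about [Balaban1987RG1] Thm 2 ∕ (0.31), nor
about the cell's target (an inhabitant of `B13TermWalkDataOneTorus.ExistsUniformAcrossSmall`); (v) no new literature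
fact is introduced: every cite tag names the printed source of an ingredient or the printed analogue of a step, the
proofs are ours.
-/

set_option autoImplicit false
namespace Literature.MathematicalPhysics.QuantumFieldTheory.Balaban1983to89.T4CubeShellMMatrix

open MeasureTheory Set Matrix
open Literature.MathematicalPhysics.QuantumFieldTheory.Balaban1983to89.T4CubeShellConditional
open Literature.MathematicalPhysics.QuantumFieldTheory.Balaban1983to89.T4CubePoincare
open Literature.MathematicalPhysics.QuantumFieldTheory.Balaban1983to89.T4CubeShellBlocks
open Literature.MathematicalPhysics.QuantumFieldTheory.Balaban1983to89.T4CubeShellProfile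
open Literature.MathematicalPhysics.QuantumFieldTheory.Balaban1983to89.T4CubeShellProfileP
open Literature.MathematicalPhysics.QuantumFieldTheory.Balaban1983to89.T4CubeShellSteinSeed
open Literature.Probability.Distributions

variable {n : ℕ}

/-! ## §1 The Z-row inequalities (finite sums) -/

section Core

/-- **Z-row lower bound**: if `H_i ≤ 0` off `k` on `I ∋ k` and `v_i ≤ v_k` on `I`, then `v_k Σ_I H ≤ Σ_I v_i H_i`. [folklore] [cite: HornJohnson2013, Cor. 5.6.17 (proof); OrtegaRheinboldt2000, Def. 13.5.1, Def. 13.5.7] -/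
theorem zrow_sum_lower {I : Finset (Fin n)} {H v : Fin n → ℝ} {k : Fin n}
    (hoff : ∀ i ∈ I, i ≠ k → H i ≤ 0) (hv : ∀ i ∈ I, v i ≤ v k) :
    v k * ∑ i ∈ I, H i ≤ ∑ i ∈ I, v i * H i := by
  rw [Finset.mul_sum]
  refine Finset.sum_le_sum fun i hi => ?_
  by_cases hik : i = k
  · rw [hik]
  · exact mul_le_mul_of_nonpos_right (hv i hi) (hoff i hi hik)

/-- **Z-row upper bound**: if `H_i ≤ 0` off `k` on `I ∋ k` and `v_k ≤ v_i` on `I`, then `Σ_I v_i H_i ≤ v_k Σ_I H`. [folklore] [cite: HornJohnson2013, Cor. 5.6.17 (proof); OrtegaRheinboldt2000, Def. 13.5.1, Def. 13.5.7] -/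
theorem zrow_sum_upper {I : Finset (Fin n)} {H v : Fin n → ℝ} {k : Fin n}
    (hoff : ∀ i ∈ I, i ≠ k → H i ≤ 0) (hv : ∀ i ∈ I, v k ≤ v i) :
    ∑ i ∈ I, v i * H i ≤ v k * ∑ i ∈ I, H i := by
  rw [Finset.mul_sum]
  refine Finset.sum_le_sum fun i hi => ?_
  by_cases hik : i = k
  · rw [hik]
  · exact mul_le_mul_of_nonpos_right (hv i hi) (hoff i hi hik)

/-- Off-diagonal part of a Z-row: `Σ_{i ∈ J} H_i ≤ 0` for `k ∉ J`, and it dominates the full off-diagonal sum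
`Σ_{i ≠ k} H_i = Σ_i H_i − H_k`. [folklore] [cite: HornJohnson2013, Def. 6.1.9; OrtegaRheinboldt2000, Def. 13.5.1, Def. 13.5.7] -/
theorem zrow_offsum_ge {H : Fin n → ℝ} {k : Fin n} (hoff : ∀ i, i ≠ k → H i ≤ 0) (J : Finset (Fin n))
    (hk : k ∉ J) : (∑ i, H i) - H k ≤ ∑ i ∈ J, H i ∧ ∑ i ∈ J, H i ≤ 0 := by
  refine ⟨?_, Finset.sum_nonpos fun i hi => hoff i (fun h => hk (h ▸ hi))⟩
  have e : (∑ i, H i) - H k = ∑ i ∈ Finset.univ.erase k, H i := by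
    rw [← Finset.sum_erase_add Finset.univ H (Finset.mem_univ k)]; ring
  have hsub : J ⊆ Finset.univ.erase k := fun i hi =>
    Finset.mem_erase.mpr ⟨fun h => hk (h ▸ hi), Finset.mem_univ i⟩
  rw [e, ← Finset.sum_sdiff hsub]
  have hneg : ∑ i ∈ Finset.univ.erase k \ J, H i ≤ 0 :=
    Finset.sum_nonpos fun i hi => hoff i (Finset.ne_of_mem_erase (Finset.mem_sdiff.mp hi).1)
  linarith

end Core

/-! ## §2 Z-row matrices: diagonal dominance and the `ℓ^∞` resolvent bound (discrete maximum principle) -/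

section Matrices

/-- A real square matrix has Z-ROWS WITH MARGINS `μ`: non-positive off-diagonal entries and row sums `≥ μ_k`. [cite: BermanPlemmons1994, Ch. 6 Thm 2.3 (I₂₇)–(I₂₉), (M₃₅); HornJohnson2013, Def. 6.1.9; OrtegaRheinboldt2000, Def. 13.5.7] -/
def ZRows (M : Matrix (Fin n) (Fin n) ℝ) (μ : Fin n → ℝ) : Prop :=
  ∀ k, (∀ i, i ≠ k → M k i ≤ 0) ∧ μ k ≤ ∑ i, M k i

/-- A Z-row matrix is diagonally dominant by rows with the margin: `μ_k + Σ_{i≠k} |M_{ki}| ≤ M_{kk}`. [cite: HornJohnson2013, Def. 6.1.9; BermanPlemmons1994, Ch. 6 Thm 2.3 (M₃₅)] -/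
theorem ZRows.diag_ge {M : Matrix (Fin n) (Fin n) ℝ} {μ : Fin n → ℝ} (hM : ZRows M μ) (k : Fin n) :
    μ k + ∑ i ∈ Finset.univ.erase k, |M k i| ≤ M k k := by
  have e : ∑ i ∈ Finset.univ.erase k, |M k i| = -∑ i ∈ Finset.univ.erase k, M k i := by
    rw [← Finset.sum_neg_distrib]
    exact Finset.sum_congr rfl fun i hi => abs_of_nonpos ((hM k).1 i (Finset.ne_of_mem_erase hi))
  have e2 : ∑ i, M k i = ∑ i ∈ Finset.univ.erase k, M k i + M k k :=
    (Finset.sum_erase_add Finset.univ (fun i => M k i) (Finset.mem_univ k)).symm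
  linarith [(hM k).2]

/-- **Signed maximum principle**: at a row `k` where `v` attains its (non-negative) maximum, `μ_k v_k ≤ (M v)_k`. [cite: HornJohnson2013, Cor. 5.6.17 (Levy–Desplanques); Varah1975] -/
theorem ZRows.mulVec_ge {M : Matrix (Fin n) (Fin n) ℝ} {μ : Fin n → ℝ} (hM : ZRows M μ) {v : Fin n → ℝ}
    {k : Fin n} (hv : ∀ i, v i ≤ v k) (hk : 0 ≤ v k) : μ k * v k ≤ (M *ᵥ v) k := by
  have h1 : μ k * v k ≤ v k * ∑ i, M k i := by
    rw [mul_comm]; exact mul_le_mul_of_nonneg_left (hM k).2 hk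
  have h2 := zrow_sum_lower (I := Finset.univ) (H := fun i => M k i) (v := v) (k := k)
    (fun i _ hik => (hM k).1 i hik) fun i _ => hv i
  have e : (M *ᵥ v) k = ∑ i, v i * M k i := by
    simp only [Matrix.mulVec, dotProduct]; exact Finset.sum_congr rfl fun i _ => mul_comm _ _
  rw [e]; exact h1.trans h2

/-- **Maximum principle in modulus**: at a row `k` where `|v|` is maximal, `μ_k |v_k| ≤ |(M v)_k|`. [cite: HornJohnson2013, Cor. 5.6.17 (Levy–Desplanques); Varah1975] -/
theorem ZRows.abs_mulVec_ge {M : Matrix (Fin n) (Fin n) ℝ} {μ : Fin n → ℝ} (hM : ZRows M μ) {v : Fin n → ℝ}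
    {k : Fin n} (hv : ∀ i, |v i| ≤ |v k|) : μ k * |v k| ≤ |(M *ᵥ v) k| := by
  by_cases hk : 0 ≤ v k
  · rw [abs_of_nonneg hk]
    refine (hM.mulVec_ge (fun i => ?_) hk).trans (le_abs_self _)
    exact (le_abs_self _).trans ((hv i).trans (abs_of_nonneg hk).le)
  · have hk' : v k < 0 := lt_of_not_ge hk
    rw [abs_of_neg hk']
    have h := hM.mulVec_ge (v := -v) (k := k) (fun i => ?_) (by simp only [Pi.neg_apply]; linarith)
    · rw [Matrix.mulVec_neg, Pi.neg_apply, Pi.neg_apply] at h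
      exact h.trans (neg_le_abs _)
    · simp only [Pi.neg_apply]
      exact (neg_le_abs _).trans ((hv i).trans (abs_of_neg hk').le)

/-- **The `ℓ^∞` resolvent bound** `‖v‖_∞ ≤ ‖M v‖_∞ ∕ m₂` for a Z-row matrix with uniform margin `m₂ > 0` (in particular
`M` is injective: an M-matrix). [cite: HornJohnson2013, Cor. 5.6.17, Thm 6.1.10 (a); Varah1975] -/
theorem ZRows.linfty_le {M : Matrix (Fin n) (Fin n) ℝ} {μ : Fin n → ℝ} (hM : ZRows M μ) {m₂ : ℝ} (hm : 0 < m₂)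
    (hμ : ∀ k, m₂ ≤ μ k) {v : Fin n → ℝ} {β : ℝ} (hb : ∀ i, |(M *ᵥ v) i| ≤ β) (i : Fin n) : |v i| ≤ β / m₂ := by
  obtain ⟨k, -, hk⟩ := Finset.exists_max_image Finset.univ (fun j => |v j|) ⟨i, Finset.mem_univ i⟩
  have hvk : ∀ j, |v j| ≤ |v k| := fun j => hk j (Finset.mem_univ j)
  rw [le_div_iff₀ hm]
  calc |v i| * m₂ ≤ |v k| * μ k := mul_le_mul (hvk i) (hμ k) hm.le (abs_nonneg _)
    _ ≤ |(M *ᵥ v) k| := by rw [mul_comm]; exact hM.abs_mulVec_ge hvk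
    _ ≤ β := hb k

/-- A Z-row matrix with positive uniform margin has trivial kernel. [cite: HornJohnson2013, Thm 6.1.10 (a); BermanPlemmons1994, Ch. 6 Thm 2.3 (I₂₇)] -/
theorem ZRows.eq_zero_of_mulVec_eq_zero {M : Matrix (Fin n) (Fin n) ℝ} {μ : Fin n → ℝ} (hM : ZRows M μ) {m₂ : ℝ}
    (hm : 0 < m₂) (hμ : ∀ k, m₂ ≤ μ k) {v : Fin n → ℝ} (hv : M *ᵥ v = 0) : v = 0 := by
  funext i
  have h := hM.linfty_le hm hμ (v := v) (β := 0) (fun j => by rw [hv, Pi.zero_apply, abs_zero]) i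
  rw [zero_div] at h
  exact abs_eq_zero.mp (le_antisymm h (abs_nonneg _))

end Matrices


/-! ## §3 The Z-ROW SUB-CLASS `P_M(m₂) ⊆ 𝔐` of potentials: ferromagnetic Hessian rows with row sums `≥ m₂`;
it contains the `λ`-Gaussian (`m₂ ≤ λ`) and is CONDITIONING-CLOSED -/

section ClassZ

/-- The Hessian row `∇∂_k f (y)` has the Z-ROW property with margin `m₂` AT EVERY POINT: `∂_i∂_k f ≤ 0` for `i ≠ k`
(ferromagnetic ∕ attractive couplings) and `Σ_i ∂_i∂_k f ≥ m₂` (the row sum — the coefficient of the constant mode —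
is bounded below).  For a quadratic `f = ½ yᵀHy` this says `H` is a Z-matrix with row sums `≥ m₂`, i.e. (for `m₂ > 0`) a
strictly row-diagonally-dominant M-matrix. [cite: OrtegaRheinboldt2000, Def. 13.5.1, Def. 13.5.7; BermanPlemmons1994, Ch. 6 Thm 2.3 (I₂₇); BrascampLieb1976, Thm 4.1] -/
def ZRow (m₂ : ℝ) (f : (Fin n → ℝ) → ℝ) : Prop :=
  ∀ k (y : Fin n → ℝ), (∀ i, i ≠ k → coordGradient (fun w => coordGradient f w k) y i ≤ 0) ∧
    m₂ ≤ ∑ i, coordGradient (fun w => coordGradient f w k) y i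

/-- The margin may be lowered. [folklore] [cite: OrtegaRheinboldt2000, Def. 13.5.7] -/
theorem zRow_mono {m₂ m₂' : ℝ} (h : m₂' ≤ m₂) {f : (Fin n → ℝ) → ℝ} (hf : ZRow m₂ f) : ZRow m₂' f :=
  fun k y => ⟨(hf k y).1, h.trans (hf k y).2⟩

/-- At every point the Hessian of a `ZRow m₂` potential is a `ZRows` matrix with uniform margin `m₂` (rows indexed by the
differentiated coordinate). [cite: Spivak1965, Thm 2-7; OrtegaRheinboldt2000, Def. 13.5.7] -/
theorem ZRow.zRows {m₂ : ℝ} {f : (Fin n → ℝ) → ℝ} (hf : ZRow m₂ f) (y : Fin n → ℝ) :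
    ZRows (Matrix.of fun k i => coordGradient (fun w => coordGradient f w k) y i) (fun _ => m₂) := fun k =>
  ⟨fun i hik => by rw [Matrix.of_apply]; exact (hf k y).1 i hik,
    by simp only [Matrix.of_apply]; exact (hf k y).2⟩

variable (𝔖 : Spec n)

/-- The `λ`-Gaussian has Hessian rows `λ e_k`: Z-rows with margin `λ`. [cite: Spivak1965, Thm 2-3 (1)–(2); BrascampLieb1976, Thm 4.1] -/
theorem zRow_gauss : ZRow 𝔖.lam 𝔖.gauss := by
  intro k y
  have e : (fun w' => coordGradient 𝔖.gauss w' k) = fun w' : Fin n → ℝ => 𝔖.lam * w' k :=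
    funext fun w' => 𝔖.coordGradient_gauss w' k
  have c : coordGradient (fun w' => coordGradient 𝔖.gauss w' k) y = fun i => if i = k then 𝔖.lam else 0 := by
    rw [e]; exact funext fun i => coordGradient_const_mul_apply 𝔖.lam k y i
  rw [c]
  refine ⟨fun i hik => by dsimp only; rw [if_neg hik], ?_⟩
  rw [Finset.sum_ite_eq' Finset.univ k (fun _ => 𝔖.lam), if_pos (Finset.mem_univ k)]

/-- **THE Z-ROW SUB-CLASS** `P_M(m₂) = 𝔐 ∩ {ZRow m₂}`. [cite: Martinelli1999, §2.4 p.103 (Def. 2.6); OrtegaRheinboldt2000, Def. 13.5.7; BermanPlemmons1994, Ch. 6 Thm 2.3 (I₂₇)] -/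
def MMatrix (m₂ : ℝ) (f : (Fin n → ℝ) → ℝ) : Prop := 𝔖.InClass f ∧ ZRow m₂ f

/-- `P_M(m₂)` is inhabited for `m₂ ≤ λ`: the `λ`-Gaussian. [cite: BrascampLieb1976, Thm 4.1; Martinelli1999, §2.4 p.103 (Def. 2.6)] -/
theorem mMatrix_gauss {m₂ : ℝ} (hm : m₂ ≤ 𝔖.lam) : MMatrix 𝔖 m₂ 𝔖.gauss :=
  ⟨𝔖.inClass_gauss, zRow_mono hm (zRow_gauss 𝔖)⟩

/-- **Z-rows pass to the regularised conditional potential (PROVED).**  Along one-sided data, on an inside row `k` the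
Hessian row of `condPot lab λ f₁ x` at `z` is the `{lab ≠ 1}`-masked Hessian row of `f` at `merge lab x z` (module IV
`coordGradient_comp_merge_right` + the `inside` field): masking an off-diagonal entry keeps it `≤ 0`, and masking the
(non-positive, `i ≠ k` since `lab k = 0 ≠ 1 = lab i`) shell entries does not decrease the row sum; on every other row
it is `λ e_k`, a Z-row with margin `λ ≥ m₂`. [cite: Spivak1965, Thm 2-2 (chain rule), Thm 2-3 (1)–(2); FriedliVelenik2017, Lemma 6.7 (6.7)–(6.10); FriedliVelenik2017, §6.10.1 (6.110); BermanPlemmons1994, Ch. 6 Thm 2.4 (iii)] -/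
theorem zRow_condPot {lab : Fin n → Fin 3} {f f₁ f₂ : (Fin n → ℝ) → ℝ} {C : ℝ} (hD : 𝔖.SideData lab f f₁ f₂ C)
    {m₂ : ℝ} (hZ : ZRow m₂ f) (hm : m₂ ≤ 𝔖.lam) (x : Fin n → ℝ) : ZRow m₂ (condPot lab 𝔖.lam f₁ x) := by
  obtain ⟨hfc, -, -, -⟩ := hD.inClass
  have hd₁ : Differentiable ℝ f₁ := hD.cd₁.differentiable (by norm_num)
  have hdk : ∀ k, Differentiable ℝ (fun y => coordGradient f y k) := fun k =>
    (contDiff_one_coordGradient hfc k).differentiable one_ne_zero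
  intro k z
  by_cases hk : lab k = 0
  · have e0 : (fun w => coordGradient (condPot lab 𝔖.lam f₁ x) w k) = fun w => coordGradient f (merge lab x w) k := by
      funext w
      rw [Spec.coordGradient_condPot_of_zero lab 𝔖.lam hd₁ hk x w, hD.inside k hk]
    have key : coordGradient (fun w' => coordGradient f (merge lab x w') k) z
        = fun i => if lab i ≠ 1 then coordGradient (fun y => coordGradient f y k) (merge lab x z) i else 0 :=
      funext fun i => coordGradient_comp_merge_right lab (hdk k) x z i
    rw [e0, key]
    refine ⟨fun i hik => ?_, ?_⟩
    · dsimp only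
      by_cases h1 : lab i ≠ 1
      · rw [if_pos h1]; exact (hZ k (merge lab x z)).1 i hik
      · rw [if_neg h1]
    · refine (hZ k (merge lab x z)).2.trans (Finset.sum_le_sum fun i _ => ?_)
      by_cases h1 : lab i ≠ 1
      · rw [if_pos h1]
      · rw [if_neg h1]
        have hik : i ≠ k := fun h => h1 (by rw [h, hk]; decide)
        exact (hZ k (merge lab x z)).1 i hik
  · have e1 : (fun w => coordGradient (condPot lab 𝔖.lam f₁ x) w k) = fun w : Fin n → ℝ => 𝔖.lam * w k := by
      funext w
      exact Spec.coordGradient_condPot_of_ne_zero lab 𝔖.lam hd₁ hD.dep₁ hk x w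
    have c : coordGradient (fun w' : Fin n → ℝ => 𝔖.lam * w' k) z = fun i => if i = k then 𝔖.lam else 0 :=
      funext fun i => coordGradient_const_mul_apply 𝔖.lam k z i
    rw [e1, c]
    refine ⟨fun i hik => by dsimp only; rw [if_neg hik], ?_⟩
    rw [Finset.sum_ite_eq' Finset.univ k (fun _ => 𝔖.lam), if_pos (Finset.mem_univ k)]
    exact hm

/-- **The Z-row sub-class `P_M(m₂)` is CONDITIONING-CLOSED for `m₂ ≤ λ` (PROVED)** — `𝔐` by module VII's
`inClass_condPot`, the Z-rows by `zRow_condPot`, both along `sideData_lo` (inside child) and `sideData_hi` (outside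
child, swapped labelling).  Hence module VIII's relative recursion ∕ barrier and module X's seed reduction apply to
`P = P_M(m₂)` (and to `P_M(m₂) ∩ 𝔐_ε`, `condClosed_mMatrix_nearGauss`). [cite: FriedliVelenik2017, Lemma 6.7 (6.7)–(6.10); FriedliVelenik2017, §6.10.1 (6.110); Martinelli1999, §2.4 p.103 (Def. 2.6); BermanPlemmons1994, Ch. 6 Thm 2.4 (iii)] -/
theorem condClosed_mMatrix {m₂ : ℝ} (hm : m₂ ≤ 𝔖.lam) : CondClosed 𝔖 (MMatrix 𝔖 m₂) := fun _ hw _ hf hM x _ =>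
  ⟨⟨𝔖.inClass_condPot (𝔖.sideData_lo hf hw) x, zRow_condPot 𝔖 (𝔖.sideData_lo hf hw) hM.2 hm x⟩,
    ⟨𝔖.inClass_condPot (𝔖.sideData_hi hf hw) x, zRow_condPot 𝔖 (𝔖.sideData_hi hf hw) hM.2 hm x⟩⟩

/-- `P_M(m₂) ∩ 𝔐_ε` (Z-rows AND small Hessian-row oscillation) is conditioning-closed, and inhabited by the Gaussian. [cite: FriedliVelenik2017, Lemma 6.7 (6.7)–(6.10); FriedliVelenik2017, §6.10.1 (6.110); Martinelli1999, §2.4 p.103 (Def. 2.6); BrascampLieb1976, Thm 4.1] -/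
theorem condClosed_mMatrix_nearGauss {m₂ : ℝ} (hm : m₂ ≤ 𝔖.lam) (ε : ℝ) :
    CondClosed 𝔖 (fun f => MMatrix 𝔖 m₂ f ∧ NearGauss 𝔖 ε f) ∧ (MMatrix 𝔖 m₂ 𝔖.gauss ∧ NearGauss 𝔖 ε 𝔖.gauss) :=
  ⟨condClosed_and 𝔖 (condClosed_mMatrix 𝔖 hm) (condClosed_nearGauss 𝔖 ε),
    mMatrix_gauss 𝔖 hm, (nearGauss_gauss 𝔖 ε 0).1⟩

/-- Diagonal Hessian entries of an `f ∈ 𝔐` are `≤ R` (entry ≤ row length). [cite: HornJohnson2013, Thm 5.1.4 (Cauchy–Schwarz)] -/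
theorem diag_le_R {f : (Fin n → ℝ) → ℝ} (hf : 𝔖.InClass f) (k : Fin n) (y : Fin n → ℝ) :
    coordGradient (fun w => coordGradient f w k) y k ≤ 𝔖.R := by
  obtain ⟨-, -, -, hrow⟩ := hf
  have h1 : coordGradient (fun w => coordGradient f w k) y k ^ 2
      ≤ coordGradient (fun w => coordGradient f w k) y ⬝ᵥ coordGradient (fun w => coordGradient f w k) y := by
    rw [sq]
    exact Finset.single_le_sum (f := fun i => coordGradient (fun w => coordGradient f w k) y i
      * coordGradient (fun w => coordGradient f w k) y i) (fun i _ => mul_self_nonneg _) (Finset.mem_univ k)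
  exact (le_abs_self _).trans (abs_le_of_sq_le_sq (h1.trans (hrow k y)) 𝔖.R_pos.le)

end ClassZ


/-! ## §4 `ℓ^∞`-MONOTONICITY OF THE GRADIENT MAP of a Z-row potential: `m₂ ‖y − y'‖_∞ ≤ ‖∇f(y) − ∇f(y')‖_∞` -/

section Monotone

/-- Derivative of a `C¹` function along the line `s ↦ y' + s v`: `Σ_i v_i ∂_i g (y' + s v)`. [cite: Spivak1965, Thm 2-2 (chain rule), Thm 2-7] -/
theorem hasDerivAt_along {g : (Fin n → ℝ) → ℝ} (hg : Differentiable ℝ g) (y' v : Fin n → ℝ) (t : ℝ) :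
    HasDerivAt (fun s : ℝ => g (y' + s • v)) (∑ i, v i * coordGradient g (y' + t • v) i) t := by
  have hline : HasDerivAt (fun s : ℝ => y' + s • v) v t := by
    have h := ((hasDerivAt_id t).smul_const v).const_add y'
    simpa only [id, one_smul] using h
  have h := (hg (y' + t • v)).hasFDerivAt.comp_hasDerivAt t hline
  have e : fderiv ℝ g (y' + t • v) v = ∑ i, v i * coordGradient g (y' + t • v) i := dD_eq_sum g v (y' + t • v)
  rw [← e]
  exact h

/-- **Signed `ℓ^∞`-monotonicity (PROVED).**  For `f ∈ C²` with Z-rows of margin `m₂`, at a coordinate `k` where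
`y − y'` attains its non-negative maximum, `m₂ (y_k − y'_k) ≤ ∂_k f(y) − ∂_k f(y')`.  Proof: `φ(s) = ∂_k f(y' + s(y−y'))`
has `φ' = Σ_i (y−y')_i ∂_i∂_k f ≥ (y−y')_k Σ_i ∂_i∂_k f ≥ m₂ (y−y')_k` (Z-row: the off-diagonal terms only help at the
maximal coordinate), then the mean value inequality. [cite: OrtegaRheinboldt2000, Def. 13.5.3, 13.5.6, Def. 13.5.7; Varah1975] -/
theorem grad_sub_ge {m₂ : ℝ} {f : (Fin n → ℝ) → ℝ} (hf : ContDiff ℝ 2 f) (hZ : ZRow m₂ f) {y y' : Fin n → ℝ}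
    {k : Fin n} (hv : ∀ i, y i - y' i ≤ y k - y' k) (hk : 0 ≤ y k - y' k) :
    m₂ * (y k - y' k) ≤ coordGradient f y k - coordGradient f y' k := by
  have hg : Differentiable ℝ (fun w => coordGradient f w k) :=
    (contDiff_one_coordGradient hf k).differentiable one_ne_zero
  have hφ := fun s => hasDerivAt_along hg y' (y - y') s
  have hdiff : Differentiable ℝ (fun s : ℝ => coordGradient f (y' + s • (y - y')) k) :=
    fun s => (hφ s).differentiableAt
  have hderiv : ∀ s, m₂ * (y k - y' k) ≤ deriv (fun s : ℝ => coordGradient f (y' + s • (y - y')) k) s := by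
    intro s
    rw [(hφ s).deriv]
    have h1 : m₂ * (y k - y' k)
        ≤ (y - y') k * ∑ i, coordGradient (fun w => coordGradient f w k) (y' + s • (y - y')) i := by
      rw [Pi.sub_apply, mul_comm]
      exact mul_le_mul_of_nonneg_left (hZ k _).2 hk
    exact h1.trans (zrow_sum_lower (I := Finset.univ) (fun i _ hik => (hZ k _).1 i hik)
      fun i _ => by simp only [Pi.sub_apply]; exact hv i)
  have hmvt := mul_sub_le_image_sub_of_le_deriv hdiff hderiv zero_le_one
  simp only [sub_zero, mul_one, one_smul, zero_smul, add_zero, add_sub_cancel] at hmvt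
  exact hmvt

/-- **`m₂ ‖y − y'‖_∞ ≤ ‖∇f(y) − ∇f(y')‖_∞` (PROVED)**: the gradient map of a Z-row potential with margin `m₂ > 0`
is `m₂`-coercive in the `ℓ^∞` norm — a dimension-free inverse bound (compare the `ℓ²` bound `λ` from convexity). [cite: OrtegaRheinboldt2000, Def. 13.5.3, 13.5.6, Def. 13.5.7; Varah1975] -/
theorem abs_sub_le_of_grad {m₂ : ℝ} (hm : 0 < m₂) {f : (Fin n → ℝ) → ℝ} (hf : ContDiff ℝ 2 f) (hZ : ZRow m₂ f)
    {y y' : Fin n → ℝ} {β : ℝ} (hβ : ∀ i, |coordGradient f y i - coordGradient f y' i| ≤ β) (i : Fin n) :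
    |y i - y' i| ≤ β / m₂ := by
  obtain ⟨k, -, hk⟩ := Finset.exists_max_image Finset.univ (fun j => |y j - y' j|) ⟨i, Finset.mem_univ i⟩
  have hvk : ∀ j, |y j - y' j| ≤ |y k - y' k| := fun j => hk j (Finset.mem_univ j)
  refine (hvk i).trans ?_
  rw [le_div_iff₀ hm, mul_comm]
  by_cases h0 : 0 ≤ y k - y' k
  · rw [abs_of_nonneg h0]
    refine (grad_sub_ge hf hZ (fun j => (le_abs_self _).trans ((hvk j).trans (abs_of_nonneg h0).le)) h0).trans
      ((le_abs_self _).trans (hβ k))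
  · have h0' : y k - y' k < 0 := lt_of_not_ge h0
    have h1 : 0 ≤ y' k - y k := by linarith
    rw [abs_of_neg h0', ← neg_sub, neg_neg]
    refine (grad_sub_ge hf hZ (fun j => ?_) h1).trans ?_
    · have := hvk j
      rw [abs_sub_comm, abs_of_neg h0'] at this
      exact (le_abs_self _).trans (by linarith)
    · exact (le_abs_self _).trans (by rw [abs_sub_comm]; exact hβ k)

/-- The gradient map of a Z-row potential with positive margin is injective (at most one critical point). [cite: OrtegaRheinboldt2000, Def. 13.5.3, 13.5.6; HornJohnson2013, Thm 6.1.10 (a)] -/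
theorem eq_of_grad_eq {m₂ : ℝ} (hm : 0 < m₂) {f : (Fin n → ℝ) → ℝ} (hf : ContDiff ℝ 2 f) (hZ : ZRow m₂ f)
    {y y' : Fin n → ℝ} (h : coordGradient f y = coordGradient f y') : y = y' := by
  funext i
  have hi := abs_sub_le_of_grad hm hf hZ (y := y) (y' := y') (β := 0)
    (fun j => by rw [h, sub_self, abs_zero]) i
  rw [zero_div] at hi
  exact sub_eq_zero.mp (abs_eq_zero.mp (le_antisymm hi (abs_nonneg _)))

end Monotone


/-! ## §5 THE INTERIOR-MODE THEOREM: with boundary data of size `≤ S` off a block `I`, the `I`-critical point of a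
Z-row potential normalised at `0` lies in `[-S(1 − m₂∕R), S(1 − m₂∕R)]^I` — it never touches the hard wall -/

section Interior

/-- Directional Z-row bound from BELOW at a maximal block coordinate: for `k ∈ I` with `p_i ≤ p_k` on `I` and `p_i ≤ S`
off `I`, `p_k Σ_i H_i + (S − p_k) Σ_{i∉I} H_i ≤ Σ_i p_i H_i`. [folklore] [cite: HornJohnson2013, Cor. 5.6.17 (proof); OrtegaRheinboldt2000, Def. 13.5.1] -/
theorem zrow_dir_lower {H p : Fin n → ℝ} {k : Fin n} {I : Finset (Fin n)} {S : ℝ} (hkI : k ∈ I)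
    (hoff : ∀ i, i ≠ k → H i ≤ 0) (hmax : ∀ i ∈ I, p i ≤ p k) (hout : ∀ i, i ∉ I → p i ≤ S) :
    p k * (∑ i, H i) + (S - p k) * (∑ i ∈ Iᶜ, H i) ≤ ∑ i, p i * H i := by
  have hI := zrow_sum_lower (I := I) (H := H) (v := p) (k := k) (fun i _ hik => hoff i hik) hmax
  have hIc : S * ∑ i ∈ Iᶜ, H i ≤ ∑ i ∈ Iᶜ, p i * H i := by
    rw [Finset.mul_sum]
    refine Finset.sum_le_sum fun i hi => ?_
    have hi' : i ∉ I := Finset.mem_compl.mp hi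
    exact mul_le_mul_of_nonpos_right (hout i hi') (hoff i fun h => hi' (h ▸ hkI))
  rw [← Finset.sum_add_sum_compl I (fun i => p i * H i), ← Finset.sum_add_sum_compl I H]
  nlinarith [hI, hIc]

/-- Directional Z-row bound from ABOVE at a minimal block coordinate: for `k ∈ I` with `p_k ≤ p_i` on `I` and `−S ≤ p_i`
off `I`, `Σ_i p_i H_i ≤ p_k Σ_i H_i − (S + p_k) Σ_{i∉I} H_i`. [folklore] [cite: HornJohnson2013, Cor. 5.6.17 (proof); OrtegaRheinboldt2000, Def. 13.5.1] -/
theorem zrow_dir_upper {H p : Fin n → ℝ} {k : Fin n} {I : Finset (Fin n)} {S : ℝ} (hkI : k ∈ I)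
    (hoff : ∀ i, i ≠ k → H i ≤ 0) (hmin : ∀ i ∈ I, p k ≤ p i) (hout : ∀ i, i ∉ I → -S ≤ p i) :
    ∑ i, p i * H i ≤ p k * (∑ i, H i) - (S + p k) * (∑ i ∈ Iᶜ, H i) := by
  have hI := zrow_sum_upper (I := I) (H := H) (v := p) (k := k) (fun i _ hik => hoff i hik) hmin
  have hIc : ∑ i ∈ Iᶜ, p i * H i ≤ -S * ∑ i ∈ Iᶜ, H i := by
    rw [Finset.mul_sum]
    refine Finset.sum_le_sum fun i hi => ?_
    have hi' : i ∉ I := Finset.mem_compl.mp hi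
    exact mul_le_mul_of_nonpos_right (hout i hi') (hoff i fun h => hi' (h ▸ hkI))
  rw [← Finset.sum_add_sum_compl I (fun i => p i * H i), ← Finset.sum_add_sum_compl I H]
  nlinarith [hI, hIc]

/-- Z-rows with margin `m₂` have diagonal `≥ m₂`; with diagonal `≤ R` this forces `m₂ ≤ R`. [cite: HornJohnson2013, Def. 6.1.9; BermanPlemmons1994, Ch. 6 Thm 2.3 (M₃₅)] -/
theorem ZRow.le_diag {m₂ : ℝ} {f : (Fin n → ℝ) → ℝ} (hZ : ZRow m₂ f) (k : Fin n) (y : Fin n → ℝ) :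
    m₂ ≤ coordGradient (fun w => coordGradient f w k) y k := by
  have h := (hZ.zRows y).diag_ge k
  simp only [Matrix.of_apply] at h
  linarith [Finset.sum_nonneg fun i (_ : i ∈ Finset.univ.erase k) =>
    abs_nonneg (coordGradient (fun w => coordGradient f w k) y i)]

/-- **Interior critical point, upper side (PROVED).**  `f ∈ C²` with Z-rows of margin `m₂ > 0`, diagonal `≤ R`, and
`∇f(0) = 0`; a block `I`, a point `p` with `|p_i| ≤ S` OFF the block and `∂_k f(p) = 0`; `k ∈ I` a coordinate where
`p` is maximal on `I` with `p_k ≥ 0`.  Then `p_k ≤ S (R − m₂)∕R`.  Proof: `φ(s) = ∂_k f(s p)` has `φ(0) = φ(1) = 0` and,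
by `zrow_dir_lower` + the Z-row bounds `Σ_i H ≥ m₂`, `m₂ − R ≤ Σ_{i∉I} H ≤ 0`: `φ' ≥ p_k R − S(R − m₂)` as long as
`p_k ≤ S` (and `φ' ≥ p_k m₂ > 0` if `p_k > S`, which is therefore impossible); the mean value inequality concludes. [cite: OrtegaRheinboldt2000, 13.5.6 (inverse isotonicity), Def. 13.5.7; Varah1975] -/
theorem crit_le {m₂ R S : ℝ} {f : (Fin n → ℝ) → ℝ} (hf : ContDiff ℝ 2 f) (hZ : ZRow m₂ f) (hm : 0 < m₂)
    (hdiag : ∀ k y, coordGradient (fun w => coordGradient f w k) y k ≤ R)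
    {I : Finset (Fin n)} (hS : 0 ≤ S) {p : Fin n → ℝ} (hout : ∀ i, i ∉ I → |p i| ≤ S) {k : Fin n} (hkI : k ∈ I)
    (h0 : coordGradient f 0 k = 0) (hcrit : coordGradient f p k = 0) (hmax : ∀ i ∈ I, p i ≤ p k) (hk : 0 ≤ p k) :
    p k ≤ S * (R - m₂) / R := by
  have hR : 0 < R := lt_of_lt_of_le hm ((hZ.le_diag k 0).trans (hdiag k 0))
  have hg : Differentiable ℝ (fun w => coordGradient f w k) :=
    (contDiff_one_coordGradient hf k).differentiable one_ne_zero
  have hφ := fun s => hasDerivAt_along hg 0 p s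
  simp only [zero_add] at hφ
  have hdiff : Differentiable ℝ (fun s : ℝ => coordGradient f (s • p) k) := fun s => (hφ s).differentiableAt
  -- the directional lower bound at every point `y`
  have hdir : ∀ y : Fin n → ℝ, p k * m₂ + (S - p k) * (∑ i ∈ Iᶜ, coordGradient (fun w => coordGradient f w k) y i)
      ≤ ∑ i, p i * coordGradient (fun w => coordGradient f w k) y i := fun y =>
    le_trans (by nlinarith [(hZ k y).2])
      (zrow_dir_lower hkI (fun i hik => (hZ k y).1 i hik) hmax fun i hi => (le_abs_self _).trans (hout i hi))
  have hoffc : ∀ y : Fin n → ℝ, m₂ - R ≤ ∑ i ∈ Iᶜ, coordGradient (fun w => coordGradient f w k) y i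
      ∧ ∑ i ∈ Iᶜ, coordGradient (fun w => coordGradient f w k) y i ≤ 0 := fun y => by
    have h := zrow_offsum_ge (fun i hik => (hZ k y).1 i hik) Iᶜ (fun h => Finset.mem_compl.mp h hkI)
    exact ⟨by linarith [h.1, (hZ k y).2, hdiag k y], h.2⟩
  have hends : coordGradient f ((1 : ℝ) • p) k - coordGradient f ((0 : ℝ) • p) k = 0 := by
    rw [one_smul, zero_smul, hcrit, h0, sub_zero]
  by_cases hpS : p k ≤ S
  · have hderiv : ∀ s, p k * R - S * (R - m₂) ≤ deriv (fun s : ℝ => coordGradient f (s • p) k) s := by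
      intro s
      rw [(hφ s).deriv]
      refine le_trans ?_ (hdir (s • p))
      nlinarith [(hoffc (s • p)).1, sub_nonneg.mpr hpS]
    have hmvt := mul_sub_le_image_sub_of_le_deriv hdiff hderiv zero_le_one
    rw [hends, sub_zero, mul_one] at hmvt
    rw [le_div_iff₀ hR]
    linarith
  · have hpS' : S < p k := lt_of_not_ge hpS
    have hderiv : ∀ s, p k * m₂ ≤ deriv (fun s : ℝ => coordGradient f (s • p) k) s := by
      intro s
      rw [(hφ s).deriv]
      refine le_trans ?_ (hdir (s • p))
      nlinarith [(hoffc (s • p)).2, hpS']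
    have hmvt := mul_sub_le_image_sub_of_le_deriv hdiff hderiv zero_le_one
    rw [hends, sub_zero, mul_one] at hmvt
    nlinarith

/-- **Interior critical point, lower side (PROVED)** — the mirror statement at a coordinate where `p` is minimal on `I`
with `p_k ≤ 0`: `−S (R − m₂)∕R ≤ p_k`. [cite: OrtegaRheinboldt2000, 13.5.6 (inverse isotonicity), Def. 13.5.7; Varah1975] -/
theorem le_crit {m₂ R S : ℝ} {f : (Fin n → ℝ) → ℝ} (hf : ContDiff ℝ 2 f) (hZ : ZRow m₂ f) (hm : 0 < m₂)
    (hdiag : ∀ k y, coordGradient (fun w => coordGradient f w k) y k ≤ R)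
    {I : Finset (Fin n)} (hS : 0 ≤ S) {p : Fin n → ℝ} (hout : ∀ i, i ∉ I → |p i| ≤ S) {k : Fin n} (hkI : k ∈ I)
    (h0 : coordGradient f 0 k = 0) (hcrit : coordGradient f p k = 0) (hmin : ∀ i ∈ I, p k ≤ p i) (hk : p k ≤ 0) :
    -(S * (R - m₂) / R) ≤ p k := by
  have hR : 0 < R := lt_of_lt_of_le hm ((hZ.le_diag k 0).trans (hdiag k 0))
  have hg : Differentiable ℝ (fun w => coordGradient f w k) :=
    (contDiff_one_coordGradient hf k).differentiable one_ne_zero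
  have hφ := fun s => hasDerivAt_along hg 0 p s
  simp only [zero_add] at hφ
  have hdiff : Differentiable ℝ (fun s : ℝ => coordGradient f (s • p) k) := fun s => (hφ s).differentiableAt
  have hdir : ∀ y : Fin n → ℝ, ∑ i, p i * coordGradient (fun w => coordGradient f w k) y i
      ≤ p k * m₂ - (S + p k) * (∑ i ∈ Iᶜ, coordGradient (fun w => coordGradient f w k) y i) := fun y =>
    le_trans (zrow_dir_upper hkI (fun i hik => (hZ k y).1 i hik) hmin
      fun i hi => (neg_le.mpr ((neg_le_abs _).trans (hout i hi))))
      (by nlinarith [(hZ k y).2])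
  have hoffc : ∀ y : Fin n → ℝ, m₂ - R ≤ ∑ i ∈ Iᶜ, coordGradient (fun w => coordGradient f w k) y i
      ∧ ∑ i ∈ Iᶜ, coordGradient (fun w => coordGradient f w k) y i ≤ 0 := fun y => by
    have h := zrow_offsum_ge (fun i hik => (hZ k y).1 i hik) Iᶜ (fun h => Finset.mem_compl.mp h hkI)
    exact ⟨by linarith [h.1, (hZ k y).2, hdiag k y], h.2⟩
  have hends : coordGradient f ((1 : ℝ) • p) k - coordGradient f ((0 : ℝ) • p) k = 0 := by
    rw [one_smul, zero_smul, hcrit, h0, sub_zero]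
  by_cases hpS : -S ≤ p k
  · have hderiv : ∀ s, deriv (fun s : ℝ => coordGradient f (s • p) k) s ≤ p k * R + S * (R - m₂) := by
      intro s
      rw [(hφ s).deriv]
      refine (hdir (s • p)).trans ?_
      nlinarith [(hoffc (s • p)).1, neg_le_iff_add_nonneg'.mp hpS]
    have hmvt := image_sub_le_mul_sub_of_deriv_le hdiff hderiv zero_le_one
    rw [hends, sub_zero, mul_one] at hmvt
    rw [← neg_div, div_le_iff₀ hR]
    linarith
  · have hpS' : p k < -S := lt_of_not_ge hpS
    have hderiv : ∀ s, deriv (fun s : ℝ => coordGradient f (s • p) k) s ≤ p k * m₂ := by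
      intro s
      rw [(hφ s).deriv]
      refine (hdir (s • p)).trans ?_
      nlinarith [(hoffc (s • p)).2, hpS']
    have hmvt := image_sub_le_mul_sub_of_deriv_le hdiff hderiv zero_le_one
    rw [hends, sub_zero, mul_one] at hmvt
    nlinarith

end Interior


/-! ## §6 THE BLOCK STATEMENT, the class `P_M(m₂)`, and the INSIDE CHILD of the cube-shell recursion: for every
boundary field in the window the conditional critical point stays `S·m₂∕R` away from every face -/

section Window

/-- **THE INTERIOR-MODE THEOREM (PROVED)**: `f ∈ C²`, Z-rows of margin `m₂ > 0`, diagonal `≤ R`, `∇f(0) = 0`; for any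
block `I` and any point `p` with `|p_i| ≤ S` off `I` and `∂_k f(p) = 0` on `I`: `|p_k| ≤ S (1 − m₂∕R)` on `I`. [cite: OrtegaRheinboldt2000, 13.5.6 (inverse isotonicity), Def. 13.5.7; Varah1975] -/
theorem abs_crit_le {m₂ R S : ℝ} {f : (Fin n → ℝ) → ℝ} (hf : ContDiff ℝ 2 f) (hZ : ZRow m₂ f) (hm : 0 < m₂)
    (hdiag : ∀ k y, coordGradient (fun w => coordGradient f w k) y k ≤ R)
    {I : Finset (Fin n)} (hS : 0 ≤ S) {p : Fin n → ℝ} (hout : ∀ i, i ∉ I → |p i| ≤ S)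
    (h0 : ∀ k ∈ I, coordGradient f 0 k = 0) (hcrit : ∀ k ∈ I, coordGradient f p k = 0) (k : Fin n)
    (hkI : k ∈ I) : |p k| ≤ S * (R - m₂) / R := by
  obtain ⟨j, hjI, hj⟩ := Finset.exists_max_image I (fun i => |p i|) ⟨k, hkI⟩
  refine (hj k hkI).trans ?_
  by_cases h0j : 0 ≤ p j
  · rw [abs_of_nonneg h0j]
    exact crit_le hf hZ hm hdiag hS hout hjI (h0 j hjI) (hcrit j hjI)
      (fun i hi => (le_abs_self _).trans ((hj i hi).trans (abs_of_nonneg h0j).le)) h0j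
  · have h0j' : p j < 0 := lt_of_not_ge h0j
    rw [abs_of_neg h0j', neg_le]
    refine le_crit hf hZ hm hdiag hS hout hjI (h0 j hjI) (hcrit j hjI) (fun i hi => ?_) h0j'.le
    have h1 := hj i hi
    rw [abs_of_neg h0j'] at h1
    linarith [neg_abs_le (p i)]

variable (𝔖 : Spec n)

/-- **… for the class `P_M(m₂)`, `m₂ > 0`, with the window half-width `S` and the row bound `R` of the spec**: a member
normalised at the origin (`∇f(0) = 0` — the background field is the minimum) has, for every block `I` and every
off-block data of size `≤ S`, its `I`-critical point in `[-S(1 − m₂∕R), S(1 − m₂∕R)]^I`. [cite: OrtegaRheinboldt2000, 13.5.6; Varah1975; Martinelli1999, §2.4 p.103 (Def. 2.6)] -/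
theorem mMatrix_crit_le {m₂ : ℝ} (hm : 0 < m₂) {f : (Fin n → ℝ) → ℝ} (hf : MMatrix 𝔖 m₂ f)
    (I : Finset (Fin n)) {p : Fin n → ℝ} (hout : ∀ i, i ∉ I → |p i| ≤ 𝔖.S) (h0 : ∀ k ∈ I, coordGradient f 0 k = 0)
    (hcrit : ∀ k ∈ I, coordGradient f p k = 0) (k : Fin n) (hk : k ∈ I) : |p k| ≤ 𝔖.S * (𝔖.R - m₂) / 𝔖.R :=
  abs_crit_le hf.1.1 hf.2 hm (diag_le_R 𝔖 hf.1) 𝔖.S_pos.le hout h0 hcrit k hk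

/-- The three labels. [folklore] -/
private theorem fin3_of_ne {c : Fin 3} (h1 : c ≠ 1) (h2 : c ≠ 2) : c = 0 := by
  have key : ∀ c : Fin 3, c ≠ 1 → c ≠ 2 → c = 0 := by decide
  exact key c h1 h2

/-- **THE INSIDE CHILD NEVER TOUCHES THE WALL (PROVED).**  `f ∈ P_M(m₂)` (`m₂ > 0`) normalised at the origin, a WIDE
labelling `lab`, ANY boundary field `x` in the window `[-S,S]ⁿ`.  If `z` is critical for the inside child
`condPot lab λ (fLo lab f) x` on the inside coordinates (`∂_k = 0` for `lab k = 0`), then `|z_k| ≤ S(1 − m₂∕R)` on the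
inside: the conditional critical point keeps the distance `S m₂∕R` from every face of the hard window — for this class the
corner phenomenon of the located obstruction (memo §0y.41 (d), (W-0): a non-Z-row member whose conditional mode is
pushed to `−6.67·S`) cannot occur.  Proof: on an inside row `∂_k condPot(z) = ∂_k f(merge lab x z)` (module VII), which by
finite range and width equals `∂_k f(p)` at the comparison point `p = (z on inside, x on the shell, 0 outside)`;
`abs_crit_le` with the block `I = {lab = 0}`. [cite: FriedliVelenik2017, Lemma 6.7 (6.7)–(6.10); FriedliVelenik2017, §6.10.1 (6.110); OrtegaRheinboldt2000, 13.5.6; Martinelli1999, §2.4 p.103 (Def. 2.6)] -/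
theorem condPot_crit_le {m₂ : ℝ} (hm : 0 < m₂) {f : (Fin n → ℝ) → ℝ} (hf : MMatrix 𝔖 m₂ f)
    {lab : Fin n → Fin 3} (hw : 𝔖.Wide lab) (h0 : ∀ k, lab k = 0 → coordGradient f 0 k = 0) {x : Fin n → ℝ}
    (hx : x ∈ cube n 𝔖.S) {z : Fin n → ℝ}
    (hcrit : ∀ k, lab k = 0 → coordGradient (condPot lab 𝔖.lam (fLo lab f) x) z k = 0) (k : Fin n) (hk : lab k = 0) :
    |z k| ≤ 𝔖.S * (𝔖.R - m₂) / 𝔖.R := by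
  have hD := 𝔖.sideData_lo hf.1 hw
  have hd₁ : Differentiable ℝ (fLo lab f) := hD.cd₁.differentiable (by norm_num)
  obtain ⟨hfc, -, hloc, -⟩ := (hf.1 : 𝔖.InClass f)
  have hout : ∀ i, i ∉ Finset.univ.filter (fun i => lab i = 0) →
      |(fun i => if lab i = 0 then z i else if lab i = 1 then x i else 0) i| ≤ 𝔖.S := by
    intro i hi
    have hi0 : lab i ≠ 0 := fun h => hi (Finset.mem_filter.mpr ⟨Finset.mem_univ i, h⟩)
    dsimp only
    rw [if_neg hi0]
    by_cases hi1 : lab i = 1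
    · rw [if_pos hi1]; exact mem_cube_iff.mp hx i
    · rw [if_neg hi1, abs_zero]; exact 𝔖.S_pos.le
  have hcritp : ∀ k ∈ Finset.univ.filter (fun i => lab i = 0),
      coordGradient f (fun i => if lab i = 0 then z i else if lab i = 1 then x i else 0) k = 0 := by
    intro k hk
    have hk0 : lab k = 0 := (Finset.mem_filter.mp hk).2
    have e1 : coordGradient (condPot lab 𝔖.lam (fLo lab f) x) z k = coordGradient f (merge lab x z) k := by
      rw [Spec.coordGradient_condPot_of_zero lab 𝔖.lam hd₁ hk0 x z, hD.inside k hk0]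
    have e2 : coordGradient f (merge lab x z) k
        = coordGradient f (fun i => if lab i = 0 then z i else if lab i = 1 then x i else 0) k := by
      refine hloc k fun i hi => ?_
      have hi2 : lab i ≠ 2 := 𝔖.ball_subset_of_zero hw hk0 hi
      by_cases hi1 : lab i = 1
      · have hi0 : lab i ≠ 0 := by rw [hi1]; decide
        rw [merge_apply_shell hi1]
        dsimp only
        rw [if_neg hi0, if_pos hi1]
      · rw [merge_apply_of_ne hi1]
        dsimp only
        rw [if_pos (fin3_of_ne hi1 hi2)]
    rw [← e2, ← e1]
    exact hcrit k hk0
  have h := abs_crit_le hfc hf.2 hm (diag_le_R 𝔖 hf.1) 𝔖.S_pos.le hout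
    (fun k hk => h0 k (Finset.mem_filter.mp hk).2) hcritp k (Finset.mem_filter.mpr ⟨Finset.mem_univ k, hk⟩)
  rw [if_pos hk] at h
  exact h

/-- The same bound read as a DISTANCE TO THE WALL: `S·m₂∕R ≤ S − |z_k|` on the inside. [cite: FriedliVelenik2017, Lemma 6.7 (6.7)–(6.10); FriedliVelenik2017, §6.10.1 (6.110); OrtegaRheinboldt2000, 13.5.6; Martinelli1999, §2.4 p.103 (Def. 2.6)] -/
theorem condPot_crit_dist {m₂ : ℝ} (hm : 0 < m₂) {f : (Fin n → ℝ) → ℝ} (hf : MMatrix 𝔖 m₂ f)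
    {lab : Fin n → Fin 3} (hw : 𝔖.Wide lab) (h0 : ∀ k, lab k = 0 → coordGradient f 0 k = 0) {x : Fin n → ℝ}
    (hx : x ∈ cube n 𝔖.S) {z : Fin n → ℝ}
    (hcrit : ∀ k, lab k = 0 → coordGradient (condPot lab 𝔖.lam (fLo lab f) x) z k = 0) (k : Fin n) (hk : lab k = 0) :
    𝔖.S * m₂ / 𝔖.R ≤ 𝔖.S - |z k| := by
  have h := condPot_crit_le 𝔖 hm hf hw h0 hx hcrit k hk
  have e : 𝔖.S * (𝔖.R - m₂) / 𝔖.R = 𝔖.S - 𝔖.S * m₂ / 𝔖.R := by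
    rw [mul_sub, sub_div, mul_div_cancel_right₀ _ 𝔖.R_pos.ne']
  linarith

end Window

/-! ## §7 THE INTERIOR-MODE PROPERTY IS CONDITIONING-CLOSED: the margin is DEPTH-INDEPENDENT along the whole
conditioning orbit of a normalised Z-row action -/

section Closed

variable (𝔖 : Spec n)

/-- **INTERIOR-MODE PROPERTY with margin `δ`**: for every block `I` and every point `p` whose OFF-block coordinates
lie in the window `[-S,S]`, if `p` is `I`-critical (`∂_k f(p) = 0` on `I`) then its block coordinates lie in the
shrunken window `[-(S − δ), S − δ]`. [cite: Martinelli1999, §2.4 p.103 (Def. 2.6); OrtegaRheinboldt2000, 13.5.6; FriedliVelenik2017, Lemma 6.7 (6.7)–(6.10)] -/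
def IntMode (δ : ℝ) (f : (Fin n → ℝ) → ℝ) : Prop :=
  ∀ (I : Finset (Fin n)) (p : Fin n → ℝ), (∀ i, i ∉ I → |p i| ≤ 𝔖.S) → (∀ k ∈ I, coordGradient f p k = 0) →
    ∀ k ∈ I, |p k| ≤ 𝔖.S - δ

/-- The margin may be lowered. [folklore] [cite: Martinelli1999, §2.4 p.103 (Def. 2.6)] -/
theorem intMode_mono {δ δ' : ℝ} (h : δ' ≤ δ) {f : (Fin n → ℝ) → ℝ} (hf : IntMode 𝔖 δ f) : IntMode 𝔖 δ' f :=
  fun I p hout hcrit k hk => (hf I p hout hcrit k hk).trans (by linarith)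

/-- **A normalised member of `P_M(m₂)` has the interior-mode property with margin `S·m₂∕R`** (`mMatrix_crit_le`). [cite: OrtegaRheinboldt2000, 13.5.6; Varah1975; Martinelli1999, §2.4 p.103 (Def. 2.6)] -/
theorem intMode_of_mMatrix {m₂ : ℝ} (hm : 0 < m₂) {f : (Fin n → ℝ) → ℝ} (hf : MMatrix 𝔖 m₂ f)
    (h0 : ∀ k, coordGradient f 0 k = 0) : IntMode 𝔖 (𝔖.S * m₂ / 𝔖.R) f := fun I p hout hcrit k hk => by
  have h := mMatrix_crit_le 𝔖 hm hf I hout (fun k _ => h0 k) hcrit k hk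
  have e : 𝔖.S * (𝔖.R - m₂) / 𝔖.R = 𝔖.S - 𝔖.S * m₂ / 𝔖.R := by
    rw [mul_sub, sub_div, mul_div_cancel_right₀ _ 𝔖.R_pos.ne']
  linarith

/-- The `λ`-Gaussian has the interior-mode property with every margin `δ ≤ S` (its block-critical points are `0`). [cite: BrascampLieb1976, Thm 4.1; Martinelli1999, §2.4 p.103 (Def. 2.6)] -/
theorem intMode_gauss {δ : ℝ} (hδ : δ ≤ 𝔖.S) : IntMode 𝔖 δ 𝔖.gauss := fun I p hout hcrit k hk => by
  have h := hcrit k hk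
  rw [𝔖.coordGradient_gauss p k] at h
  rw [(mul_eq_zero.mp h).resolve_left 𝔖.lam_pos.ne', abs_zero]
  linarith

/-- **The interior-mode property passes to the regularised conditional potential (PROVED)** — with the SAME margin.
On a non-inside row the child's critical equation is `λ p_k = 0`; on an inside row it is the PARENT's critical equation
`∂_k f (merge lab x p) = 0` (module VII), and `merge lab x p` has off-block coordinates in the window because the shell
data `x` do.  No derivative estimate is involved: the comparison is always with the parent. [cite: Spivak1965, Thm 2-2 (chain rule), Thm 2-3 (1)–(2); FriedliVelenik2017, Lemma 6.7 (6.7)–(6.10); FriedliVelenik2017, §6.10.1 (6.110); Martinelli1999, §2.4 p.103 (Def. 2.6)] -/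
theorem intMode_condPot {lab : Fin n → Fin 3} {f f₁ f₂ : (Fin n → ℝ) → ℝ} {C : ℝ} (hD : 𝔖.SideData lab f f₁ f₂ C)
    {δ : ℝ} (hQ : IntMode 𝔖 δ f) (hδ : δ ≤ 𝔖.S) {x : Fin n → ℝ} (hx : x ∈ cube n 𝔖.S) :
    IntMode 𝔖 δ (condPot lab 𝔖.lam f₁ x) := by
  have hd₁ : Differentiable ℝ f₁ := hD.cd₁.differentiable (by norm_num)
  have hzero : ∀ (p : Fin n → ℝ) (k : Fin n), lab k ≠ 0 →
      coordGradient (condPot lab 𝔖.lam f₁ x) p k = 0 → p k = 0 := by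
    intro p k hk h
    rw [Spec.coordGradient_condPot_of_ne_zero lab 𝔖.lam hd₁ hD.dep₁ hk x p] at h
    exact (mul_eq_zero.mp h).resolve_left 𝔖.lam_pos.ne'
  intro I p hout hcrit k hk
  by_cases hk0 : lab k = 0
  · have hout' : ∀ i, i ∉ I.filter (fun i => lab i = 0) → |merge lab x p i| ≤ 𝔖.S := by
      intro i hi
      by_cases hi1 : lab i = 1
      · rw [merge_apply_shell hi1]; exact mem_cube_iff.mp hx i
      · rw [merge_apply_of_ne hi1]
        by_cases hiI : i ∈ I
        · have hi0 : lab i ≠ 0 := fun h => hi (Finset.mem_filter.mpr ⟨hiI, h⟩)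
          rw [hzero p i hi0 (hcrit i hiI), abs_zero]; exact 𝔖.S_pos.le
        · exact hout i hiI
    have hcrit' : ∀ k' ∈ I.filter (fun i => lab i = 0), coordGradient f (merge lab x p) k' = 0 := by
      intro k' hk'
      obtain ⟨hk'I, hk'0⟩ := Finset.mem_filter.mp hk'
      have e : coordGradient (condPot lab 𝔖.lam f₁ x) p k' = coordGradient f (merge lab x p) k' := by
        rw [Spec.coordGradient_condPot_of_zero lab 𝔖.lam hd₁ hk'0 x p, hD.inside k' hk'0]
      rw [← e]; exact hcrit k' hk'I
    have h := hQ _ _ hout' hcrit' k (Finset.mem_filter.mpr ⟨hk, hk0⟩)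
    rwa [merge_apply_of_ne (show lab k ≠ 1 by rw [hk0]; decide)] at h
  · rw [hzero p k hk0 (hcrit k hk), abs_zero]; linarith

/-- **`IntMode δ` IS CONDITIONING-CLOSED (`δ ≤ S`)** — along `sideData_lo` (inside child) and `sideData_hi` (outside
child).  This is the typed form of «the interior-mode margin is depth-independent»: it survives every further
conditioning step with shell data in the window, with the same `δ`. [cite: FriedliVelenik2017, Lemma 6.7 (6.7)–(6.10); FriedliVelenik2017, §6.10.1 (6.110); Martinelli1999, §2.4 p.103 (Def. 2.6)] -/
theorem condClosed_intMode {δ : ℝ} (hδ : δ ≤ 𝔖.S) : CondClosed 𝔖 (IntMode 𝔖 δ) := fun _ hw _ hf hQ _ hx =>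
  ⟨intMode_condPot 𝔖 (𝔖.sideData_lo hf hw) hQ hδ hx, intMode_condPot 𝔖 (𝔖.sideData_hi hf hw) hQ hδ hx⟩

/-- The margin `S·m₂∕R` of the Z-row class is at most `S` when `m₂ ≤ λ` (`λ ≤ R`). [folklore] [cite: Martinelli1999, §2.1 p.98] -/
theorem margin_le_S {m₂ : ℝ} (hm : m₂ ≤ 𝔖.lam) : 𝔖.S * m₂ / 𝔖.R ≤ 𝔖.S := by
  rw [div_le_iff₀ 𝔖.R_pos]
  exact mul_le_mul_of_nonneg_left (hm.trans 𝔖.lam_le) 𝔖.S_pos.le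

/-- **THE ROAD-(d) CLASS IS CONDITIONING-CLOSED**: `P_M(m₂) ∩ 𝔐_ε ∩ IntMode δ` for `m₂ ≤ λ`, `δ ≤ S` — so module
VIII's relative recursion ∕ barrier and module X's seed reduction run INSIDE a class all of whose members have their
block-critical points `δ` away from the hard wall, for every block and all off-block data in the window. [cite: FriedliVelenik2017, Lemma 6.7 (6.7)–(6.10); FriedliVelenik2017, §6.10.1 (6.110); Martinelli1999, §2.4 p.103 (Def. 2.6); BermanPlemmons1994, Ch. 6 Thm 2.4 (iii)] -/
theorem condClosed_roadD {m₂ : ℝ} (hm : m₂ ≤ 𝔖.lam) (ε : ℝ) {δ : ℝ} (hδ : δ ≤ 𝔖.S) :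
    CondClosed 𝔖 (fun f => (MMatrix 𝔖 m₂ f ∧ NearGauss 𝔖 ε f) ∧ IntMode 𝔖 δ f) :=
  condClosed_and 𝔖 (condClosed_mMatrix_nearGauss 𝔖 hm ε).1 (condClosed_intMode 𝔖 hδ)

/-- … it contains the `λ`-Gaussian … [cite: BrascampLieb1976, Thm 4.1; Martinelli1999, §2.4 p.103 (Def. 2.6)] -/
theorem roadD_gauss {m₂ : ℝ} (hm : m₂ ≤ 𝔖.lam) (ε : ℝ) {δ : ℝ} (hδ : δ ≤ 𝔖.S) :
    (MMatrix 𝔖 m₂ 𝔖.gauss ∧ NearGauss 𝔖 ε 𝔖.gauss) ∧ IntMode 𝔖 δ 𝔖.gauss :=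
  ⟨(condClosed_mMatrix_nearGauss 𝔖 hm ε).2, intMode_gauss 𝔖 hδ⟩

/-- … and every NORMALISED member of `P_M(m₂) ∩ 𝔐_ε` (`∇f(0) = 0`: the background field is the minimum), with the
margin `δ = S·m₂∕R`. [cite: OrtegaRheinboldt2000, 13.5.6; Martinelli1999, §2.4 p.103 (Def. 2.6)] -/
theorem roadD_mem {m₂ : ℝ} (hm : 0 < m₂) {ε : ℝ} {f : (Fin n → ℝ) → ℝ} (hf : MMatrix 𝔖 m₂ f) (hε : NearGauss 𝔖 ε f)
    (h0 : ∀ k, coordGradient f 0 k = 0) : (MMatrix 𝔖 m₂ f ∧ NearGauss 𝔖 ε f) ∧ IntMode 𝔖 (𝔖.S * m₂ / 𝔖.R) f :=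
  ⟨⟨hf, hε⟩, intMode_of_mMatrix 𝔖 hm hf h0⟩

/-- **DEPTH-INDEPENDENCE ALONG THE ORBIT (PROVED).**  Every member of the conditioning orbit (module VIII `Orbit`) of a
normalised action `f₀ ∈ P_M(m₂)`, `0 < m₂ ≤ λ`, is in `P_M(m₂)` and has the interior-mode property with the SAME margin
`S·m₂∕R`: all conditional critical points of all descendants — for every block and all off-block data in the window —
keep the distance `S·m₂∕R` from the hard wall. [cite: Martinelli1999, §2.4 p.103 (Def. 2.6); Martinelli1999, §2.4 Thm 2.7; FriedliVelenik2017, Lemma 6.7 (6.7)–(6.10); FriedliVelenik2017, §6.10.1 (6.110); OrtegaRheinboldt2000, 13.5.6] -/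
theorem orbit_intMode {m₂ : ℝ} (hm : 0 < m₂) (hml : m₂ ≤ 𝔖.lam) {f₀ : (Fin n → ℝ) → ℝ} (hf₀ : MMatrix 𝔖 m₂ f₀)
    (h0 : ∀ k, coordGradient f₀ 0 k = 0) (f : (Fin n → ℝ) → ℝ) (hf : Orbit 𝔖 f₀ f) :
    MMatrix 𝔖 m₂ f ∧ IntMode 𝔖 (𝔖.S * m₂ / 𝔖.R) f :=
  orbit_le 𝔖 (condClosed_and 𝔖 (condClosed_mMatrix 𝔖 hml) (condClosed_intMode 𝔖 (margin_le_S 𝔖 hml)))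
    ⟨hf₀, intMode_of_mMatrix 𝔖 hm hf₀ h0⟩ f hf

end Closed

/-! ## §8 THE SOLVING DIRECTION HAS UNIFORMLY BOUNDED `ℓ¹`-MASS: `m₂ ‖w‖₁ ≤ ‖f_xx(y) w‖₁` for a Z-row potential,
hence `‖w‖₁ ≤ a ∕ m₂` for module X's direction `g_xx(z₀) w = ∇G(z₀)` -/

section L1

/-- **Z-column `ℓ¹` bound**: if `M` has non-positive off-diagonal entries and COLUMN sums `≥ m₂`, then
`m₂ Σ_i |w_i| ≤ Σ_k |(M w)_k|` for every `w`.  Proof: test `M w` against `σ = sign w`: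
`Σ_k σ_k (Mw)_k = Σ_i w_i Σ_k σ_k M_{ki} ≥ Σ_i |w_i| Σ_k M_{ki}` (diagonal term `= |w_i| M_{ii}`, off-diagonal terms
`w_i σ_k M_{ki} ≥ |w_i| M_{ki}` since `M_{ki} ≤ 0`). [cite: HornJohnson2013, §5.6 (maximum column sum norm), Cor. 5.6.17; Varah1975] -/
theorem zcol_l1_le {M : Matrix (Fin n) (Fin n) ℝ} {m₂ : ℝ} (hoff : ∀ k i, k ≠ i → M k i ≤ 0)
    (hcol : ∀ i, m₂ ≤ ∑ k, M k i) (w : Fin n → ℝ) : m₂ * ∑ i, |w i| ≤ ∑ k, |(M *ᵥ w) k| := by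
  set σ : Fin n → ℝ := fun k => if 0 ≤ w k then 1 else -1 with hσ
  have hσabs : ∀ k, |σ k| ≤ 1 := fun k => by
    simp only [hσ]; split_ifs <;> simp
  have hσw : ∀ k, σ k * w k = |w k| := fun k => by
    simp only [hσ]; split_ifs with h
    · rw [one_mul, abs_of_nonneg h]
    · rw [neg_one_mul, abs_of_neg (lt_of_not_ge h)]
  have h1 : ∑ k, σ k * (M *ᵥ w) k ≤ ∑ k, |(M *ᵥ w) k| := Finset.sum_le_sum fun k _ => by
    calc σ k * (M *ᵥ w) k ≤ |σ k * (M *ᵥ w) k| := le_abs_self _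
      _ = |σ k| * |(M *ᵥ w) k| := abs_mul _ _
      _ ≤ 1 * |(M *ᵥ w) k| := mul_le_mul_of_nonneg_right (hσabs k) (abs_nonneg _)
      _ = |(M *ᵥ w) k| := one_mul _
  have h2 : ∑ k, σ k * (M *ᵥ w) k = ∑ i, w i * ∑ k, σ k * M k i := by
    simp only [Matrix.mulVec, dotProduct, Finset.mul_sum]
    rw [Finset.sum_comm]
    exact Finset.sum_congr rfl fun i _ => Finset.sum_congr rfl fun k _ => by ring
  have h3 : ∀ i, |w i| * m₂ ≤ w i * ∑ k, σ k * M k i := by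
    intro i
    have step : ∀ k, |w i| * M k i ≤ w i * (σ k * M k i) := by
      intro k
      by_cases hki : k = i
      · rw [hki, ← mul_assoc, mul_comm (w i) (σ i), hσw i]
      · have hle : w i * σ k ≤ |w i| := by
          calc w i * σ k ≤ |w i * σ k| := le_abs_self _
            _ = |w i| * |σ k| := abs_mul _ _
            _ ≤ |w i| * 1 := mul_le_mul_of_nonneg_left (hσabs k) (abs_nonneg _)
            _ = |w i| := mul_one _
        rw [← mul_assoc]
        exact mul_le_mul_of_nonpos_right hle (hoff k i hki)
    calc |w i| * m₂ ≤ |w i| * ∑ k, M k i := mul_le_mul_of_nonneg_left (hcol i) (abs_nonneg _)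
      _ = ∑ k, |w i| * M k i := by rw [Finset.mul_sum]
      _ ≤ ∑ k, w i * (σ k * M k i) := Finset.sum_le_sum fun k _ => step k
      _ = w i * ∑ k, σ k * M k i := by rw [Finset.mul_sum]
  calc m₂ * ∑ i, |w i| = ∑ i, |w i| * m₂ := by
        rw [Finset.mul_sum]; exact Finset.sum_congr rfl fun i _ => mul_comm _ _
    _ ≤ ∑ i, w i * ∑ k, σ k * M k i := Finset.sum_le_sum fun i _ => h3 i
    _ = ∑ k, σ k * (M *ᵥ w) k := h2.symm
    _ ≤ ∑ k, |(M *ᵥ w) k| := h1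

/-- For a `ZRow m₂` potential the Hessian MATRIX `f_xx(y)` (`coordHessian`, entry `(k,i) = ∂_k∂_i f`) is a Z-matrix
with COLUMN sums `≥ m₂` — `ZRow` bounds exactly the columns `∇∂_i f`; no symmetry of second partials is used — so
`m₂ ‖w‖₁ ≤ ‖f_xx(y) w‖₁`: the Hessian is `m₂`-coercive `ℓ¹ → ℓ¹` (and, by `abs_sub_le_of_grad`, `ℓ^∞ → ℓ^∞`). [cite: HornJohnson2013, §5.6 (maximum column sum norm); Spivak1965, Thm 2-7; Varah1975] -/
theorem ZRow.hessian_l1_le {m₂ : ℝ} {f : (Fin n → ℝ) → ℝ} (hZ : ZRow m₂ f) (y w : Fin n → ℝ) :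
    m₂ * ∑ i, |w i| ≤ ∑ k, |(coordHessian f y *ᵥ w) k| :=
  zcol_l1_le (fun k i hki => by rw [← coordGradient_coordGradient_eq]; exact (hZ i y).1 k hki)
    (fun i => (hZ i y).2.trans_eq (Finset.sum_congr rfl fun k _ => coordGradient_coordGradient_eq f y k i)) w

/-- **THE SOLVING DIRECTION HAS BOUNDED `ℓ¹`-MASS (PROVED)**: `g ∈ ZRow m₂` (`m₂ > 0`), `g_xx(z₀) w = u` with `u`
supported in `B` and `|u_i| ≤ 1` ⇒ `‖w‖₁ ≤ #B ∕ m₂`. [cite: HornJohnson2013, §0.5 (nonsingularity and the inverse), §5.6 (maximum column sum norm); Varah1975] -/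
theorem ZRow.dir_l1_le {m₂ : ℝ} (hm : 0 < m₂) {g : (Fin n → ℝ) → ℝ} (hZ : ZRow m₂ g) (z₀ : Fin n → ℝ)
    {u w : Fin n → ℝ} (hw : coordHessian g z₀ *ᵥ w = u) {B : Finset (Fin n)} (hu0 : ∀ i, i ∉ B → u i = 0)
    (hu1 : ∀ i, |u i| ≤ 1) : ∑ i, |w i| ≤ B.card / m₂ := by
  rw [le_div_iff₀ hm, mul_comm]
  refine (hZ.hessian_l1_le z₀ w).trans ?_
  rw [hw, ← Finset.sum_subset (Finset.subset_univ B) (fun i _ hi => by rw [hu0 i hi, abs_zero])]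
  calc ∑ i ∈ B, |u i| ≤ ∑ i ∈ B, (1 : ℝ) := Finset.sum_le_sum fun i _ => hu1 i
    _ = B.card := by rw [Finset.sum_const, nsmul_eq_mul, mul_one]

variable (𝔖 : Spec n)

/-- **… for module X's direction**: along one-sided data over a `ZRow m₂` parent (`0 < m₂ ≤ λ`), the solving direction
`g_xx(z₀) w = ∇G(z₀)` of the gradient partner `G = C⁻¹ ∂_j f₁ ∘ merge_x` (module X: `∇G` supported in `B_r(j)`,
entries `≤ 1`) has `‖w‖₁ ≤ a ∕ m₂` — UNIFORMLY in `n`, the data, and the base point.  (Combes–Thomas gives decay of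
`w_k` in `d(k,j)` but not a volume-free `ℓ¹` bound: the decay rate `μ` is tied to `λ ∕ (R a)`, not to the volume
growth.) [cite: FriedliVelenik2017, Lemma 6.7 (6.7); BrascampLieb1976, Thm 4.1; CombesThomas1973, §II; Varah1975] -/
theorem dir_l1_le_partner {lab : Fin n → Fin 3} {f f₁ f₂ : (Fin n → ℝ) → ℝ} {C : ℝ} (hD : 𝔖.SideData lab f f₁ f₂ C)
    {m₂ : ℝ} (hm : 0 < m₂) (hZ : ZRow m₂ f) (hml : m₂ ≤ 𝔖.lam) (x : Fin n → ℝ) {j : Fin n} (hj : lab j = 1)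
    {w z₀ : Fin n → ℝ} (hw : coordHessian (condPot lab 𝔖.lam f₁ x) z₀ *ᵥ w
      = coordGradient (fun z => C⁻¹ * coordGradient f₁ (merge lab x z) j) z₀) :
    ∑ k, |w k| ≤ 𝔖.a / m₂ := by
  have h := (zRow_condPot 𝔖 hD hZ hml x).dir_l1_le hm z₀ hw
    (fun i hi => partner_grad_support 𝔖 hD x hj z₀ hi) (fun i => partner_grad_abs_le 𝔖 hD x hj z₀ i)
  exact h.trans (div_le_div_of_nonneg_right (by exact_mod_cast 𝔖.card_ball_le_a j) hm.le)

/-- Consequently module X's CRUDE (W3) radius `δ_H ≤ ‖w‖₁ ε` (`hessian_mulVec_osc`) is already uniform on the Z-row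
class: `δ_H ≤ (a ∕ m₂) ε`. [cite: BrascampLieb1976, Thm 4.1; Varah1975] -/
theorem dir_l1_osc_le {lab : Fin n → Fin 3} {f f₁ f₂ : (Fin n → ℝ) → ℝ} {C : ℝ} (hD : 𝔖.SideData lab f f₁ f₂ C)
    {m₂ : ℝ} (hm : 0 < m₂) (hZ : ZRow m₂ f) (hml : m₂ ≤ 𝔖.lam) (x : Fin n → ℝ) {j : Fin n} (hj : lab j = 1)
    {w z₀ : Fin n → ℝ} (hw : coordHessian (condPot lab 𝔖.lam f₁ x) z₀ *ᵥ w
      = coordGradient (fun z => C⁻¹ * coordGradient f₁ (merge lab x z) j) z₀) {ε : ℝ} (hε : 0 ≤ ε) :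
    (∑ k, |w k|) * ε ≤ 𝔖.a / m₂ * ε :=
  mul_le_mul_of_nonneg_right (dir_l1_le_partner 𝔖 hD hm hZ hml x hj hw) hε

end L1


/-! ## §9 THE WALL TERM SPLITS INTO FACES: `Wall_w(Ψ) = Σ_l w_l Wall_{e_l}(Ψ)`, so on the Z-row class module X's
remaining input is a bound on the `2n` PER-FACE fluxes `Wall_{e_l}(Φ̃)` — whose modes §7 keeps `S·m₂∕R` inside -/

section Faces

variable (𝔖 : Spec n) (P : ((Fin n → ℝ) → ℝ) → Prop)

/-- `⟨Σ_k c_k A_k⟩_K = Σ_k c_k ⟨A_k⟩_K` (continuous potential and inserts). [cite: Durrett2019, Thm 1.4.7 (ii)–(iii); GlimmJaffe1987, §4.3 (proof of Cor. 4.3.3)] -/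
theorem cubeMean_sum_mul {f : (Fin n → ℝ) → ℝ} (hf : Continuous f) {A : Fin n → (Fin n → ℝ) → ℝ}
    (hA : ∀ k, Continuous (A k)) (c : Fin n → ℝ) (S : ℝ) :
    cubeMean f S (fun x => ∑ k, c k * A k x) = ∑ k, c k * cubeMean f S (A k) := by
  unfold cubeMean
  have hE : Continuous fun x => Real.exp (-f x) := continuous_expNeg hf
  have e : (fun x => (∑ k, c k * A k x) * Real.exp (-f x)) = fun x => ∑ k, c k * (A k x * Real.exp (-f x)) := by
    funext x; rw [Finset.sum_mul]; exact Finset.sum_congr rfl fun k _ => mul_assoc _ _ _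
  have hI : ∀ k ∈ (Finset.univ : Finset (Fin n)),
      Integrable (fun x => c k * (A k x * Real.exp (-f x))) (volume.restrict (cube n S)) := by
    intro k _
    have h := (integrableOn_cube' ((hA k).mul hE) S).const_mul (c k)
    exact h
  rw [e, integral_finsetSum Finset.univ hI, Finset.sum_div]
  exact Finset.sum_congr rfl fun k _ => by rw [integral_const_mul, mul_div_assoc]

/-- **The wall functional is LINEAR IN THE DIRECTION**: `Wall_w(Ψ) = Σ_l w_l Wall_{e_l}(Ψ)` (`g, Ψ ∈ C¹`; each
`Wall_{e_l}` is the normalised flux through the two faces `{z_l = ±S}`, module X `wallDefect_single_mul_cubeMass`). [cite: GlimmJaffe1987, §9.1 (9.1.32); Spivak1965, Thm 2-7, Thm 4-13] -/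
theorem wallDefect_eq_sum {S : ℝ} {g Ψ : (Fin n → ℝ) → ℝ} (hg : ContDiff ℝ 1 g) (hΨ : ContDiff ℝ 1 Ψ)
    (w : Fin n → ℝ) : wallDefect g S w Ψ = ∑ l, w l * wallDefect g S (Pi.single l 1) Ψ := by
  have hgc : Continuous g := hg.continuous
  have hdΨ : ∀ l, Continuous fun z => coordGradient Ψ z l := fun l => by
    have h := continuous_dD hΨ (Pi.single l 1)
    rwa [dD_single] at h
  have hdg : ∀ l, Continuous fun z => Ψ z * coordGradient g z l := fun l => by
    have h := continuous_dD hg (Pi.single l 1)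
    rw [dD_single] at h
    exact hΨ.continuous.mul h
  have e1 : dD Ψ w = fun z => ∑ l, w l * coordGradient Ψ z l := funext fun z => dD_eq_sum Ψ w z
  have e2 : (fun z => Ψ z * dD g w z) = fun z => ∑ l, w l * (Ψ z * coordGradient g z l) := by
    funext z; rw [dD_eq_sum, Finset.mul_sum]; exact Finset.sum_congr rfl fun l _ => by ring
  have e3 : ∀ l, wallDefect g S (Pi.single l 1) Ψ
      = cubeMean g S (fun z => coordGradient Ψ z l) - cubeMean g S (fun z => Ψ z * coordGradient g z l) := by
    intro l; unfold wallDefect; rw [dD_single, dD_single]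
  calc wallDefect g S w Ψ
      = cubeMean g S (fun z => ∑ l, w l * coordGradient Ψ z l)
          - cubeMean g S (fun z => ∑ l, w l * (Ψ z * coordGradient g z l)) := by
        unfold wallDefect; rw [e1, e2]
    _ = ∑ l, w l * (cubeMean g S (fun z => coordGradient Ψ z l)
          - cubeMean g S (fun z => Ψ z * coordGradient g z l)) := by
        rw [cubeMean_sum_mul hgc hdΨ w S, cubeMean_sum_mul hgc hdg w S, ← Finset.sum_sub_distrib]
        exact Finset.sum_congr rfl fun l _ => by rw [mul_sub]
    _ = ∑ l, w l * wallDefect g S (Pi.single l 1) Ψ := Finset.sum_congr rfl fun l _ => by rw [e3]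

/-- **`|Wall_w(Ψ)| ≤ ‖w‖₁ · max_l |Wall_{e_l}(Ψ)|`.** [cite: GlimmJaffe1987, §9.1 (9.1.32); HornJohnson2013, §5.6 (maximum column sum norm)] -/
theorem abs_wallDefect_le {S : ℝ} {g Ψ : (Fin n → ℝ) → ℝ} (hg : ContDiff ℝ 1 g) (hΨ : ContDiff ℝ 1 Ψ)
    (w : Fin n → ℝ) {ω : ℝ} (hω : ∀ l, |wallDefect g S (Pi.single l 1) Ψ| ≤ ω) :
    |wallDefect g S w Ψ| ≤ (∑ l, |w l|) * ω := by
  rw [wallDefect_eq_sum hg hΨ w, Finset.sum_mul]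
  refine (Finset.abs_sum_le_sum_abs _ _).trans (Finset.sum_le_sum fun l _ => ?_)
  rw [abs_mul]
  exact mul_le_mul_of_nonneg_left (hω l) (abs_nonneg _)

/-- **THE SEED ON THE Z-ROW CLASS FROM PER-FACE WALL TERMS (PROVED REDUCTION).**  Range `r ≥ 1`, `μ ≥ 0` with
`R a (e^μ − 1) ≤ λ∕2`, `P ⊆ {RowOsc ε} ∩ {ZRow m₂}` with `0 < m₂ ≤ λ`.  If for every exact child triple of a `P`-parent
at separation `s₀` some base point `z₀` with THE solving direction `w` and some `ω` bounding the `2n` face terms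
`|Wall_{e_l}(Φ − ⟨Φ⟩_K)|` give  `a²(2∕λ) e^{−μ s₀∕r} + (a∕m₂) ω + λ⁻¹(C⁻¹ + a∕λ) ε ≤ ρ ∕ (c A q)`,  then
`c A q κ^E_P(s₀) ≤ ρ` (module X `kappaE_seed_of_wallCT` + `dir_l1_le_partner` + `abs_wallDefect_le`).  On the road-(d)
class of §7 every such child has all its block-critical points `S·m₂∕R` inside the window (`orbit_intMode`); the
PER-FACE estimate turning that into a small `ω` is NOT proved in this file (header (i)). [cite: CombesThomas1973, §II; BrascampLieb1976, Thm 4.1; Varah1975; GlimmJaffe1987, §9.1 (9.1.32); Martinelli1999, §2.4 p.103 (Def. 2.6, Thm 2.7); HelfferSjostrand1994; Ledoux2001, Prop. 6.2 p.190] -/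
theorem kappaE_seed_of_faces (hr : 0 < 𝔖.r) {μ : ℝ} (hμ : 0 ≤ μ)
    (hsmall : 𝔖.R * 𝔖.a * (Real.exp μ - 1) ≤ 𝔖.lam / 2) {ε : ℝ} (hε : 0 ≤ ε) (hPε : ∀ f, P f → RowOsc ε f)
    {m₂ : ℝ} (hm : 0 < m₂) (hml : m₂ ≤ 𝔖.lam) (hPZ : ∀ f, P f → ZRow m₂ f)
    {s₀ : ℕ} {A q ρ : ℝ} (hA : 0 < A) (hq : 0 < q) (hρ : 0 ≤ ρ)
    (h : ∀ (lab : Fin n → Fin 3) (f f₁ f₂ : (Fin n → ℝ) → ℝ) (C : ℝ) (x : Fin n → ℝ) (j : Fin n)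
      (F : (Fin n → ℝ) → ℝ) (B : Finset (Fin n)),
      𝔖.SideData lab f f₁ f₂ C → x ∈ cube n 𝔖.S → lab j = 1 → P f → P (condPot lab 𝔖.lam f₁ x) → 𝔖.Obs F B →
        (∀ i ∈ B, lab i = 0) → (∀ i ∈ B, s₀ + 𝔖.r < 𝔖.d i j) →
        ∃ (w z₀ : Fin n → ℝ) (ω : ℝ),
          coordHessian (condPot lab 𝔖.lam f₁ x) z₀ *ᵥ w
            = coordGradient (fun z => C⁻¹ * coordGradient f₁ (merge lab x z) j) z₀ ∧
          (∀ l, |wallDefect (condPot lab 𝔖.lam f₁ x) 𝔖.S (Pi.single l 1) (fun z => F (merge lab x z)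
                - cubeMean (condPot lab 𝔖.lam f₁ x) 𝔖.S (fun z => F (merge lab x z)))| ≤ ω) ∧
          (𝔖.a : ℝ) ^ 2 * (2 / 𝔖.lam * Real.exp (-(μ * ((s₀ : ℝ) / 𝔖.r)))) + 𝔖.a / m₂ * ω
            + 𝔖.lam⁻¹ * (C⁻¹ + 𝔖.a / 𝔖.lam) * ε ≤ ρ / (𝔖.cst * A * q)) :
    𝔖.cst * A * q * kappaE 𝔖 P s₀ ≤ ρ := by
  refine kappaE_seed_of_wallCT 𝔖 P hr hμ hsmall hε hPε hA hq hρ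
    fun lab f f₁ f₂ C x j F B hD hx hj hPf hPc hF hB0 hB1 => ?_
  obtain ⟨w, z₀, ω, hw, hωl, hsum⟩ := h lab f f₁ f₂ C x j F B hD hx hj hPf hPc hF hB0 hB1
  refine ⟨w, z₀, hw, ?_⟩
  obtain ⟨hgc2, -, -, -⟩ := 𝔖.inClass_condPot hD x
  have hΦ : ContDiff ℝ 1 (fun z => F (merge lab x z)
      - cubeMean (condPot lab 𝔖.lam f₁ x) 𝔖.S (fun z => F (merge lab x z))) :=
    (hF.1.comp (contDiff_merge_right lab x)).sub contDiff_const
  have hwall := abs_wallDefect_le (S := 𝔖.S) (hgc2.of_le (by norm_num)) hΦ w hωl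
  have hl1 := dir_l1_le_partner 𝔖 hD hm (hPZ f hPf) hml x hj hw
  have hω0 : 0 ≤ ω := (abs_nonneg _).trans (hωl j)
  have hle := hwall.trans (mul_le_mul_of_nonneg_right hl1 hω0)
  linarith

end Faces

end Literature.MathematicalPhysics.QuantumFieldTheory.Balaban1983to89.T4CubeShellMMatrix
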